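import Summits.MatrixMultiplication.MatrixMultiplication.Theorems.SnSubsetDichotomyThresholdSubsetTriplesThinnedCoset
import Summits.MatrixMultiplication.MatrixMultiplication.Theorems.ThresholdSubsetTriples.Negative.ThinnedYoungCells

/-!
# `ThresholdSubsetTriples` (crux stmt-MatrixMultiplication-10882): a ℤ/3-symmetric threshold witness is not a
# sub-exponential thinning of a Young coset ("thinned Young cosets die")

Negative-side helper (line lead c2, 2026-08-17; `sorry`-free, standard axioms).  Every optimum of the symmetric design
searches (lead censuses c2, c4 §5: n = 6, 9, 12) is a THINNED YOUNG COSET `S ⊆ Y·a` (`Y` Young, one 6-block,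
`θ = |Y|/|S| ∈ {1, 10, 15}`); this file proves that whole structure class dead at the crux's scale, with exponential margin:

* `thinnedYoung_card_le` — for every `c` there is `n₀` such that for `n ≥ n₀`: `S ⊆ Y·a` (`Y = youngSubgroup f`),
  `TPP(S, gS, g²S)` (translate form of the ℤ/3-symmetric ansatz) and `|Y| ≤ e^{n/(400 log n)}·|S|` imply
  `|S| ≤ √(n!)·e^{-c√n}`.
* `thinnedYoung_card_le_const` — the same with a constant thinning factor `|Y| ≤ C|S|`.
* `not_thinnedYoungSymmetricDesign` — the `∀ c > 0` design family "symmetric witnesses thinned out of Young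
  cosets by `≤ e^{n/(400 log n)}`" is empty.

## Proof

1. Thinned-coset packing (landed `stub_thinnedCosetPacking`, p135068) for the pairs `(S, gS)`, `(S, g²S)` (pair
   conditions from the TPP): the meets `Y ∩ gYg⁻¹`, `Y ∩ g²Yg⁻²` (and the conjugate `gYg⁻¹ ∩ g²Yg⁻²`) have order
   `≤ θ² ≤ e^{2t}`, `t = n/(400 log n)`.
2. `Y ∩ kYk⁻¹` is the Young subgroup of the pair labelling `(f, f∘k⁻¹)`, of order `∏ m_cell!`, and `2^m ≤ (m!)²`
   (`m ≥ 2`): the points in cells of size `≥ 2` number `≤ 4t/log 2` per pair; their union `D` has `|D|·23 log n ≤ n`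
   (toolkit `ThinnedYoungCells`).
3. Delete `D`: on `P = Dᶜ` (`n' ≥ n/2` points) the three restricted labellings have pairwise trivially-meeting Young
   subgroups — the ONLY hypothesis of the tree's analytic core of Blasiak–Church–Cohn–Grochow–Umans 2017 Thm 4.2
   (`sum_card_block_mul_le_real` + `young_sum_log_le_of_costs`): `Λ₁+Λ₂+Λ₃ ≤ (3/2) n' log n' − (9/5) n'`.
4. Cost transfer (`sum_cost_le_restrict`): each full cost sum (`≥ log|Y|`, `log_card_youngSubgroup_le_sum_cost`;
   the three labellings have conjugate Young subgroups of equal order) exceeds its restriction by `≤ |D|(log n + 2)`.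
5. Bookkeeping (`real_core`): `log|S| ≤ log|Y| ≤ ½ n log n − 0.57 n`, but the threshold gives
   `log|S| > ½ log n! − c√n ≥ ½ n log n − ½ n − c√n`, i.e. `0.07 n < c√n` — false once `√n ≥ 15c`.

Not covered: fat overgroups (`θ = e^{Θ(n log n)}`).  References: BCCGU 2017 (arXiv:1712.02302) §4 Thm 4.2 (tree
`YoungSubgroupBarrierProofs`); `Census-c4-CapsAndChainEngine.md` §5 (iv); `Lines/triality-uniquely-cubing-translate-dead.md` item 3.
-/

set_option linter.dupNamespace false

noncomputable section

open Finset Real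

namespace Summit.MatrixMultiplication.MatrixMultiplication.Theorems.ThresholdSubsetTriples.Negative

open Literature.Combinatorics.Additive
open Literature.Barriers.MatrixMultiplication

variable {n : ℕ}

/-! ### C. The meets of `Y`, `gYg⁻¹`, `g²Yg⁻²` are small for a thinned symmetric witness -/

/-- The filter of a subgroup has its order. -/
theorem card_filter_mem_eq (H : Subgroup (Equiv.Perm (Fin n))) [DecidablePred (· ∈ H)] :
    (univ.filter fun z : Equiv.Perm (Fin n) => z ∈ H).card = Nat.card H := by
  rw [Nat.card_eq_fintype_card, Fintype.card_subtype]

/-- The meet `Y ∩ kYk⁻¹` as the Young subgroup of the pair labelling `(f, f ∘ k⁻¹)`. -/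
theorem card_filter_meet_eq (f : Fin n → ℕ) (k : Equiv.Perm (Fin n)) :
    (univ.filter fun z : Equiv.Perm (Fin n) =>
        z ∈ youngSubgroup f ∧ k⁻¹ * z * k ∈ youngSubgroup f).card =
      Nat.card (youngSubgroup (fun x => (f x, (f ∘ ⇑k⁻¹) x))) := by
  rw [← card_filter_mem_eq]
  congr 1
  ext z
  simp only [mem_filter, mem_univ, true_and, youngSubgroup_pair_eq_inf, Subgroup.mem_inf,
    mem_youngSubgroup_comp_inv]

/-- A set in a right coset of `Y` is at most as large as `Y`. -/
theorem card_le_card_young (f : Fin n → ℕ) (a : Equiv.Perm (Fin n)) (S : Finset (Equiv.Perm (Fin n)))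
    (hS : ∀ s ∈ S, s * a⁻¹ ∈ youngSubgroup f) : S.card ≤ Nat.card (youngSubgroup f) := by
  rw [← card_filter_mem_eq, ← Finset.card_image_of_injective S (mul_left_injective a⁻¹)]
  refine Finset.card_le_card fun z hz => ?_
  obtain ⟨s, hs, rfl⟩ := Finset.mem_image.1 hz
  simpa using hS s hs

/-- **Thinned-coset packing, Young form**: for `S ⊆ Y·a` with the `(S, kS)` pair condition,
`|S|²·|Y ∩ kYk⁻¹| ≤ |Y|²` (landed `stub_thinnedCosetPacking`, p135068). -/
theorem sq_mul_meet_le (f : Fin n → ℕ) (a k : Equiv.Perm (Fin n)) (S : Finset (Equiv.Perm (Fin n)))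
    (hS : ∀ s ∈ S, s * a⁻¹ ∈ youngSubgroup f)
    (hpair : ∀ s ∈ S, ∀ s' ∈ S, ∀ t ∈ S, ∀ t' ∈ S, s * s'⁻¹ * (k * t * (k * t')⁻¹) = 1 → s = s' ∧ t = t') :
    S.card ^ 2 * Nat.card (youngSubgroup (fun x => (f x, (f ∘ ⇑k⁻¹) x))) ≤
      Nat.card (youngSubgroup f) ^ 2 := by
  have h := stub_thinnedCosetPacking (youngSubgroup f) a k S hS hpair
  rw [card_filter_meet_eq, card_filter_mem_eq] at h
  simpa [sq] using h

/-- **Big cells of a pair labelling are few**: `#big · log 2 ≤ 2 log |Y_{h₁} ∩ Y_{h₂}|`. -/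
theorem card_bigPts_mul_log_two_le (h₁ h₂ : Fin n → ℕ) :
    ((univ.filter fun x => 2 ≤ (univ.filter fun y => (h₁ y, h₂ y) = (h₁ x, h₂ x)).card).card : ℝ) *
        Real.log 2 ≤ 2 * Real.log (Nat.card (youngSubgroup (fun x => (h₁ x, h₂ x)))) := by
  have hpos : 0 < Nat.card (youngSubgroup (fun x => (h₁ x, h₂ x))) := Nat.card_pos
  have key := two_pow_card_bigPts_le (fun x => (h₁ x, h₂ x))
  beta_reduce at key
  have key' : ((2 : ℝ)) ^ (univ.filter fun x => 2 ≤ (univ.filter fun y => (h₁ y, h₂ y) = (h₁ x, h₂ x)).card).card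
      ≤ ((Nat.card (youngSubgroup (fun x => (h₁ x, h₂ x))) : ℕ) : ℝ) ^ 2 := by
    exact_mod_cast key
  have := Real.log_le_log (by positivity) key'
  rw [Real.log_pow, Real.log_pow] at this
  simpa using this

/-! ### D. Assembly -/

/-- The linear bookkeeping of the proof. -/
theorem real_core {N δ L : ℝ} (hlogN : 14 ≤ Real.log N) (hδ0 : 0 ≤ δ)
    (hδ : δ * (23 * Real.log N) ≤ N)
    (h3 : 3 * L ≤ 3 / 2 * (N - δ) * Real.log N - 9 / 5 * (N - δ) + 3 * (δ * (Real.log N + 2))) :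
    L ≤ 1 / 2 * N * Real.log N - 57 / 100 * N := by
  have hA : δ * Real.log N ≤ N / 23 := by
    have : δ * (23 * Real.log N) = 23 * (δ * Real.log N) := by ring
    rw [this] at hδ
    linarith
  have hB : δ ≤ N / 322 := by
    have h1 : δ * 14 ≤ δ * Real.log N := mul_le_mul_of_nonneg_left hlogN hδ0
    linarith
  nlinarith [hA, hB, h3, mul_nonneg hδ0 (by linarith : (0:ℝ) ≤ Real.log N)]

/-- **Abstract core**: three labellings of `[n]` with Young subgroups of a common order `Y` whose three
pairwise meets have order `≤ e^{2t}`, `t = n/(400 log n)`, satisfy `log Y ≤ ½ n log n − 0.57 n` (for `n ≥ 2e^{14}`).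
(Delete the big cells, run the tree's BCCGU core on the kept points, transfer the costs back.) -/
theorem log_card_le_of_meets (hn1 : 2 * Real.exp 14 ≤ (n : ℝ)) (f₁ f₂ f₃ : Fin n → ℕ) (Y : ℕ)
    (hY1 : Nat.card (youngSubgroup f₁) = Y) (hY2 : Nat.card (youngSubgroup f₂) = Y)
    (hY3 : Nat.card (youngSubgroup f₃) = Y)
    (h12 : Real.log (Nat.card (youngSubgroup (fun x => (f₁ x, f₂ x)))) ≤ 2 * ((n : ℝ) / (400 * Real.log n)))
    (h13 : Real.log (Nat.card (youngSubgroup (fun x => (f₁ x, f₃ x)))) ≤ 2 * ((n : ℝ) / (400 * Real.log n)))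
    (h23 : Real.log (Nat.card (youngSubgroup (fun x => (f₂ x, f₃ x)))) ≤ 2 * ((n : ℝ) / (400 * Real.log n))) :
    Real.log Y ≤ 1 / 2 * n * Real.log n - 57 / 100 * n := by
  classical
  have he14 : 0 < Real.exp 14 := Real.exp_pos 14
  have hnpos : (0 : ℝ) < n := by linarith
  have hlog_half : 14 ≤ Real.log ((n : ℝ) / 2) := by
    rw [Real.le_log_iff_exp_le (by linarith)]
    linarith
  have hlogn : 14 ≤ Real.log n :=
    hlog_half.trans (Real.log_le_log (by linarith) (by linarith))
  have hlogn_pos : 0 < Real.log n := by linarith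
  set t : ℝ := (n : ℝ) / (400 * Real.log n) with ht_def
  have ht0 : 0 ≤ t := by positivity
  -- big points are few: each pair contributes at most `4t / log 2`
  have hlog2 : 0.6931471803 < Real.log 2 := Real.log_two_gt_d9
  have hD12 : ((univ.filter fun x => 2 ≤ (univ.filter fun y => (f₁ y, f₂ y) = (f₁ x, f₂ x)).card).card : ℝ) * Real.log 2 ≤ 4 * t := by
    have := card_bigPts_mul_log_two_le f₁ f₂
    linarith
  have hD13 : ((univ.filter fun x => 2 ≤ (univ.filter fun y => (f₁ y, f₃ y) = (f₁ x, f₃ x)).card).card : ℝ) * Real.log 2 ≤ 4 * t := by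
    have := card_bigPts_mul_log_two_le f₁ f₃
    linarith
  have hD23 : ((univ.filter fun x => 2 ≤ (univ.filter fun y => (f₂ y, f₃ y) = (f₂ x, f₃ x)).card).card : ℝ) * Real.log 2 ≤ 4 * t := by
    have := card_bigPts_mul_log_two_le f₂ f₃
    linarith
  -- the deleted set `D` and the kept set `P`
  set D : Finset (Fin n) := (univ.filter fun x => 2 ≤ (univ.filter fun y => (f₁ y, f₂ y) = (f₁ x, f₂ x)).card) ∪ (univ.filter fun x => 2 ≤ (univ.filter fun y => (f₁ y, f₃ y) = (f₁ x, f₃ x)).card) ∪ (univ.filter fun x => 2 ≤ (univ.filter fun y => (f₂ y, f₃ y) = (f₂ x, f₃ x)).card) with hD_def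
  have hDcard : (D.card : ℝ) * Real.log 2 ≤ 12 * t := by
    have h1 : D.card ≤ (univ.filter fun x => 2 ≤ (univ.filter fun y => (f₁ y, f₂ y) = (f₁ x, f₂ x)).card).card + (univ.filter fun x => 2 ≤ (univ.filter fun y => (f₁ y, f₃ y) = (f₁ x, f₃ x)).card).card + (univ.filter fun x => 2 ≤ (univ.filter fun y => (f₂ y, f₃ y) = (f₂ x, f₃ x)).card).card :=
      (Finset.card_union_le _ _).trans (Nat.add_le_add_right (Finset.card_union_le _ _) _)
    have h1' : (D.card : ℝ) ≤ (univ.filter fun x => 2 ≤ (univ.filter fun y => (f₁ y, f₂ y) = (f₁ x, f₂ x)).card).card + (univ.filter fun x => 2 ≤ (univ.filter fun y => (f₁ y, f₃ y) = (f₁ x, f₃ x)).card).card + (univ.filter fun x => 2 ≤ (univ.filter fun y => (f₂ y, f₃ y) = (f₂ x, f₃ x)).card).card := by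
      exact_mod_cast h1
    nlinarith
  set P : Finset (Fin n) := Dᶜ with hP_def
  have hPc : Pᶜ = D := by rw [hP_def, compl_compl]
  have hcardP : (P.card : ℝ) = n - D.card := by
    have h1 : P.card = n - D.card := by
      rw [hP_def, Finset.card_compl, Fintype.card_fin]
    have h2 : D.card ≤ n := by simpa using Finset.card_le_univ D
    rw [h1, Nat.cast_sub h2]
  -- `δ := |D|` is small: `δ · 23 log n ≤ n`
  have hδ : (D.card : ℝ) * (23 * Real.log n) ≤ n := by
    have h1 : (D.card : ℝ) * Real.log 2 * (400 * Real.log n) ≤ 12 * n := by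
      have := mul_le_mul_of_nonneg_right hDcard (by positivity : (0:ℝ) ≤ 400 * Real.log n)
      rwa [ht_def, show 12 * ((n : ℝ) / (400 * Real.log n)) * (400 * Real.log n) = 12 * n by
        field_simp] at this
    nlinarith [Nat.cast_nonneg (α := ℝ) D.card]
  have hδ' : (D.card : ℝ) ≤ n / 322 := by
    have h1 : (D.card : ℝ) * (23 * 14) ≤ (D.card : ℝ) * (23 * Real.log n) := by
      apply mul_le_mul_of_nonneg_left _ (Nat.cast_nonneg _); linarith
    have : (D.card : ℝ) * 322 ≤ n := by linarith
    rw [le_div_iff₀ (by norm_num)]; linarith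
  -- the kept set is large
  have hn' : (n : ℝ) / 2 ≤ P.card := by rw [hcardP]; linarith
  have hn'pos : (0 : ℝ) < (P.card : ℕ) := by
    have : (0:ℝ) < (n:ℝ) / 2 := by linarith
    exact_mod_cast (show (0:ℝ) < P.card by linarith)
  have hn'14 : 14 ≤ Real.log (P.card : ℕ) :=
    hlog_half.trans (Real.log_le_log (by linarith) hn')
  have hlogn' : Real.log (P.card : ℕ) ≤ Real.log n :=
    Real.log_le_log hn'pos (by rw [hcardP]; linarith [Nat.cast_nonneg (α := ℝ) D.card])
  -- restricted labellings meet pairwise trivially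
  have hmemP : ∀ x ∈ P, x ∉ D := fun x hx => by
    rw [hP_def, Finset.mem_compl] at hx; exact hx
  have b12 := inf_eq_bot_restrict f₁ f₂ P fun x hx hbig => hmemP x hx (by
    rw [hD_def, Finset.mem_union, Finset.mem_union]
    exact Or.inl (Or.inl hbig))
  have b13 := inf_eq_bot_restrict f₁ f₃ P fun x hx hbig => hmemP x hx (by
    rw [hD_def, Finset.mem_union, Finset.mem_union]
    exact Or.inl (Or.inr hbig))
  have b23 := inf_eq_bot_restrict f₂ f₃ P fun x hx hbig => hmemP x hx (by
    rw [hD_def, Finset.mem_union]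
    exact Or.inr hbig)
  -- the analytic core of BCCGU 2017 Thm 4.2 on the kept points
  have hcore := young_sum_log_le_of_costs (n := P.card) hn'pos hn'14
    (fun x' => (univ.filter fun y : Fin P.card => f₁ ((P.equivFin.symm y : P) : Fin n) = f₁ ((P.equivFin.symm x' : P) : Fin n)).card) (fun x' => (univ.filter fun y : Fin P.card => f₂ ((P.equivFin.symm y : P) : Fin n) = f₂ ((P.equivFin.symm x' : P) : Fin n)).card) (fun x' => (univ.filter fun y : Fin P.card => f₃ ((P.equivFin.symm y : P) : Fin n) = f₃ ((P.equivFin.symm x' : P) : Fin n)).card)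
    (one_le_card_block _) (one_le_card_block _) (one_le_card_block _)
    (sum_card_block_mul_le_real b12) (sum_card_block_mul_le_real b23) (sum_card_block_mul_le_real b13)
    (le_refl _) (le_refl _) (le_refl _)
  beta_reduce at hcore
  -- cost transfers: `log Y ≤ Λ_k + |D|(log n + 2)` for the three labellings
  have hc1 : ∀ a : ℕ, 1 ≤ a → (fun a : ℕ => Real.log a - 1 + (1 + Real.log a) / a) a ≤ Real.log a :=
    fun a ha => cost_le_log_nat ha
  have hc2 : ∀ a b : ℕ, 1 ≤ b → b ≤ a →
      (fun a : ℕ => Real.log a - 1 + (1 + Real.log a) / a) a -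
        (fun a : ℕ => Real.log a - 1 + (1 + Real.log a) / a) b ≤ 2 * (((a - b : ℕ) : ℝ) / b) :=
    fun a b hb hab => cost_sub_cost_le hb hab
  have hL1 : Real.log Y ≤ (∑ x' : Fin P.card, (Real.log ((univ.filter fun y : Fin P.card => f₁ ((P.equivFin.symm y : P) : Fin n) = f₁ ((P.equivFin.symm x' : P) : Fin n)).card : ℕ) - 1 + (1 + Real.log ((univ.filter fun y : Fin P.card => f₁ ((P.equivFin.symm y : P) : Fin n) = f₁ ((P.equivFin.symm x' : P) : Fin n)).card : ℕ)) / ((univ.filter fun y : Fin P.card => f₁ ((P.equivFin.symm y : P) : Fin n) = f₁ ((P.equivFin.symm x' : P) : Fin n)).card : ℕ))) + (D.card : ℝ) * (Real.log n + 2) := by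
    have h1 := log_card_youngSubgroup_le_sum_cost f₁
    rw [hY1] at h1
    have h2 := sum_cost_le_restrict _ hc1 hc2 f₁ P
    beta_reduce at h2
    rw [hPc] at h2
    exact h1.trans h2
  have hL2 : Real.log Y ≤ (∑ x' : Fin P.card, (Real.log ((univ.filter fun y : Fin P.card => f₂ ((P.equivFin.symm y : P) : Fin n) = f₂ ((P.equivFin.symm x' : P) : Fin n)).card : ℕ) - 1 + (1 + Real.log ((univ.filter fun y : Fin P.card => f₂ ((P.equivFin.symm y : P) : Fin n) = f₂ ((P.equivFin.symm x' : P) : Fin n)).card : ℕ)) / ((univ.filter fun y : Fin P.card => f₂ ((P.equivFin.symm y : P) : Fin n) = f₂ ((P.equivFin.symm x' : P) : Fin n)).card : ℕ))) + (D.card : ℝ) * (Real.log n + 2) := by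
    have h1 := log_card_youngSubgroup_le_sum_cost f₂
    rw [hY2] at h1
    have h2 := sum_cost_le_restrict _ hc1 hc2 f₂ P
    beta_reduce at h2
    rw [hPc] at h2
    exact h1.trans h2
  have hL3 : Real.log Y ≤ (∑ x' : Fin P.card, (Real.log ((univ.filter fun y : Fin P.card => f₃ ((P.equivFin.symm y : P) : Fin n) = f₃ ((P.equivFin.symm x' : P) : Fin n)).card : ℕ) - 1 + (1 + Real.log ((univ.filter fun y : Fin P.card => f₃ ((P.equivFin.symm y : P) : Fin n) = f₃ ((P.equivFin.symm x' : P) : Fin n)).card : ℕ)) / ((univ.filter fun y : Fin P.card => f₃ ((P.equivFin.symm y : P) : Fin n) = f₃ ((P.equivFin.symm x' : P) : Fin n)).card : ℕ))) + (D.card : ℝ) * (Real.log n + 2) := by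
    have h1 := log_card_youngSubgroup_le_sum_cost f₃
    rw [hY3] at h1
    have h2 := sum_cost_le_restrict _ hc1 hc2 f₃ P
    beta_reduce at h2
    rw [hPc] at h2
    exact h1.trans h2
  -- bookkeeping
  have hsum : (∑ x' : Fin P.card, (Real.log ((univ.filter fun y : Fin P.card => f₁ ((P.equivFin.symm y : P) : Fin n) = f₁ ((P.equivFin.symm x' : P) : Fin n)).card : ℕ) - 1 + (1 + Real.log ((univ.filter fun y : Fin P.card => f₁ ((P.equivFin.symm y : P) : Fin n) = f₁ ((P.equivFin.symm x' : P) : Fin n)).card : ℕ)) / ((univ.filter fun y : Fin P.card => f₁ ((P.equivFin.symm y : P) : Fin n) = f₁ ((P.equivFin.symm x' : P) : Fin n)).card : ℕ))) + (∑ x' : Fin P.card, (Real.log ((univ.filter fun y : Fin P.card => f₂ ((P.equivFin.symm y : P) : Fin n) = f₂ ((P.equivFin.symm x' : P) : Fin n)).card : ℕ) - 1 + (1 + Real.log ((univ.filter fun y : Fin P.card => f₂ ((P.equivFin.symm y : P) : Fin n) = f₂ ((P.equivFin.symm x' : P) : Fin n)).card : ℕ)) / ((univ.filter fun y : Fin P.card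 => f₂ ((P.equivFin.symm y : P) : Fin n) = f₂ ((P.equivFin.symm x' : P) : Fin n)).card : ℕ))) + (∑ x' : Fin P.card, (Real.log ((univ.filter fun y : Fin P.card => f₃ ((P.equivFin.symm y : P) : Fin n) = f₃ ((P.equivFin.symm x' : P) : Fin n)).card : ℕ) - 1 + (1 + Real.log ((univ.filter fun y : Fin P.card => f₃ ((P.equivFin.symm y : P) : Fin n) = f₃ ((P.equivFin.symm x' : P) : Fin n)).card : ℕ)) / ((univ.filter fun y : Fin P.card => f₃ ((P.equivFin.symm y : P) : Fin n) = f₃ ((P.equivFin.symm x' : P) : Fin n)).card : ℕ))) ≤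
      3 / 2 * (P.card : ℕ) * Real.log (P.card : ℕ) - 9 / 5 * (P.card : ℕ) := hcore
  have hmono : 3 / 2 * ((P.card : ℕ) : ℝ) * Real.log (P.card : ℕ) ≤ 3 / 2 * ((P.card : ℕ) : ℝ) * Real.log n :=
    mul_le_mul_of_nonneg_left hlogn' (by positivity)
  have h3 : 3 * Real.log Y ≤ 3 / 2 * ((n : ℝ) - D.card) * Real.log n - 9 / 5 * ((n : ℝ) - D.card) +
      3 * ((D.card : ℝ) * (Real.log n + 2)) := by
    rw [← hcardP]
    linarith
  exact real_core hlogn (Nat.cast_nonneg _) hδ h3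

/-- **Thinned Young cosets die.**  For every `c` there is `n₀` such that for `n ≥ n₀`: if
`S ⊆ Y·a` for a Young subgroup `Y = youngSubgroup f` of `S_n`, the ℤ/3-translate triple `(S, gS, g²S)`
has the triple product property, and the thinning factor is sub-exponential, `|Y| ≤ e^{n/(400 log n)}·|S|`,
then `|S| ≤ √(n!)·e^{-c√n}` — such an `S` is not a threshold witness at scale `c`. -/
theorem thinnedYoung_card_le (c : ℝ) : ∃ n₀ : ℕ, ∀ n ≥ n₀, ∀ (f : Fin n → ℕ)
    (g a : Equiv.Perm (Fin n)) (S : Finset (Equiv.Perm (Fin n))),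
    (∀ s ∈ S, s * a⁻¹ ∈ youngSubgroup f) →
    TripleProductProperty S (S.image (g * ·)) (S.image (g * g * ·)) →
    (Nat.card (youngSubgroup f) : ℝ) ≤ Real.exp (n / (400 * Real.log n)) * S.card →
    (S.card : ℝ) ≤ Real.sqrt (n.factorial : ℝ) * Real.exp (-(c * Real.sqrt (n : ℝ))) := by
  classical
  refine ⟨⌈2 * Real.exp 14⌉₊ + ⌈(15 * c) ^ 2⌉₊, fun n hn f g a S hS hT hθ => ?_⟩
  have hn_real : ((⌈2 * Real.exp 14⌉₊ + ⌈(15 * c) ^ 2⌉₊ : ℕ) : ℝ) ≤ n := by exact_mod_cast hn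
  push_cast at hn_real
  have hn1 : 2 * Real.exp 14 ≤ (n : ℝ) :=
    le_trans (Nat.le_ceil _) (by linarith [Nat.cast_nonneg (α := ℝ) ⌈(15 * c) ^ 2⌉₊])
  have hn2 : (15 * c) ^ 2 ≤ (n : ℝ) :=
    le_trans (Nat.le_ceil _) (by linarith [Nat.cast_nonneg (α := ℝ) ⌈2 * Real.exp 14⌉₊])
  have he14 : 0 < Real.exp 14 := Real.exp_pos 14
  have hnpos : (0 : ℝ) < n := by linarith
  have hlogn : 14 ≤ Real.log n := by
    have hlog_half : 14 ≤ Real.log ((n : ℝ) / 2) := by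
      rw [Real.le_log_iff_exp_le (by linarith)]
      linarith
    exact hlog_half.trans (Real.log_le_log (by linarith) (by linarith))
  have hlogn_pos : 0 < Real.log n := by linarith
  by_contra hlt
  push Not at hlt
  -- `S` is non-empty
  have hSpos : 0 < S.card := by
    by_contra h0
    push Not at h0
    have h0' : S.card = 0 := Nat.le_zero.1 h0
    rw [h0'] at hlt
    have : (0 : ℝ) < Real.sqrt (n.factorial : ℝ) * Real.exp (-(c * Real.sqrt (n : ℝ))) := by
      have : (0 : ℝ) < Real.sqrt (n.factorial : ℝ) := Real.sqrt_pos.2 (by exact_mod_cast Nat.factorial_pos n)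
      positivity
    simp at hlt
    linarith
  have hSposR : (0 : ℝ) < S.card := by exact_mod_cast hSpos
  set t : ℝ := (n : ℝ) / (400 * Real.log n) with ht_def
  have ht0 : 0 ≤ t := by positivity
  have hmeet : ∀ (k : Equiv.Perm (Fin n)),
      (∀ s ∈ S, ∀ s' ∈ S, ∀ t ∈ S, ∀ t' ∈ S, s * s'⁻¹ * (k * t * (k * t')⁻¹) = 1 → s = s' ∧ t = t') →
      Real.log (Nat.card (youngSubgroup (fun x => (f x, (f ∘ ⇑k⁻¹) x)))) ≤ 2 * t := by
    intro k hpair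
    have hM := sq_mul_meet_le f a k S hS hpair
    set M := Nat.card (youngSubgroup (fun x => (f x, (f ∘ ⇑k⁻¹) x))) with hM_def
    have hMpos : 0 < M := Nat.card_pos
    have hMR : ((S.card : ℝ)) ^ 2 * (M : ℝ) ≤ ((Nat.card (youngSubgroup f) : ℕ) : ℝ) ^ 2 := by
      exact_mod_cast hM
    have hY2 : ((Nat.card (youngSubgroup f) : ℕ) : ℝ) ^ 2 ≤ (Real.exp t * S.card) ^ 2 :=
      pow_le_pow_left₀ (by positivity) hθ 2
    have hM' : (M : ℝ) ≤ Real.exp t ^ 2 := by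
      have h1 : ((S.card : ℝ)) ^ 2 * (M : ℝ) ≤ (S.card : ℝ) ^ 2 * Real.exp t ^ 2 := by
        calc _ ≤ (Real.exp t * S.card) ^ 2 := hMR.trans hY2
          _ = (S.card : ℝ) ^ 2 * Real.exp t ^ 2 := by ring
      exact le_of_mul_le_mul_left h1 (by positivity)
    calc Real.log M ≤ Real.log (Real.exp t ^ 2) := Real.log_le_log (by exact_mod_cast hMpos) hM'
      _ = 2 * t := by rw [Real.log_pow, Real.log_exp]; ring
  have h12 := hmeet g (pair_of_tpp₁ hT)
  have h13 := hmeet (g * g) (pair_of_tpp₂ hT)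
  have h23 : Real.log (Nat.card (youngSubgroup (fun x => ((f ∘ ⇑g⁻¹) x, (f ∘ ⇑(g * g)⁻¹) x)))) ≤ 2 * t := by
    have hfun : (fun x => ((f ∘ ⇑g⁻¹) x, (f ∘ ⇑(g * g)⁻¹) x)) = (fun x => (f x, (f ∘ ⇑g⁻¹) x)) ∘ ⇑g⁻¹ := by
      funext z
      simp [mul_inv_rev]
    rw [hfun, card_youngSubgroup_comp_inv]
    exact h12
  have hLle := log_card_le_of_meets hn1 f (f ∘ ⇑g⁻¹) (f ∘ ⇑(g * g)⁻¹) (Nat.card (youngSubgroup f)) rfl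
    (card_youngSubgroup_comp_inv f g) (card_youngSubgroup_comp_inv f (g * g)) h12 h13 h23
  -- `|S| ≤ |Y|` and the threshold
  have hSY : Real.log S.card ≤ Real.log (Nat.card (youngSubgroup f)) :=
    Real.log_le_log hSposR (by exact_mod_cast card_le_card_young f a S hS)
  have hthr : Real.log (n.factorial : ℝ) / 2 - c * Real.sqrt n < Real.log S.card := by
    have hpos : (0 : ℝ) < Real.sqrt (n.factorial : ℝ) * Real.exp (-(c * Real.sqrt (n : ℝ))) := by
      have : (0 : ℝ) < Real.sqrt (n.factorial : ℝ) := Real.sqrt_pos.2 (by exact_mod_cast Nat.factorial_pos n)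
      positivity
    have := Real.log_lt_log hpos hlt
    rwa [Real.log_mul (Real.sqrt_pos.2 (by exact_mod_cast Nat.factorial_pos n)).ne' (Real.exp_pos _).ne',
      Real.log_exp, Real.log_sqrt (by positivity)] at this
  have hfact := sub_le_log_factorial n
  have hsq : 0 ≤ Real.sqrt (n : ℝ) := Real.sqrt_nonneg _
  have key : 7 / 100 * (n : ℝ) < c * Real.sqrt n := by linarith
  rcases le_or_gt c 0 with hc | hc
  · have : c * Real.sqrt n ≤ 0 := mul_nonpos_of_nonpos_of_nonneg hc hsq
    linarith
  · have h15 : 15 * c ≤ Real.sqrt n := by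
      calc 15 * c = Real.sqrt ((15 * c) ^ 2) := (Real.sqrt_sq (by positivity)).symm
        _ ≤ Real.sqrt n := Real.sqrt_le_sqrt hn2
    have hsqn : Real.sqrt (n : ℝ) * Real.sqrt n = n := Real.mul_self_sqrt (by positivity)
    have hc' : c ≤ Real.sqrt n / 15 := by linarith
    have hcs : c * Real.sqrt n ≤ Real.sqrt n / 15 * Real.sqrt n := mul_le_mul_of_nonneg_right hc' hsq
    have hcs' : c * Real.sqrt n ≤ n / 15 := by
      calc c * Real.sqrt n ≤ Real.sqrt n / 15 * Real.sqrt n := hcs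
        _ = n / 15 := by rw [div_mul_eq_mul_div, hsqn]
    linarith

/-- **Constant thinning factor** (the form matching the data: every optimum of the symmetric design
searches at `n ≤ 12` is a `θ`-thinned Young coset with `θ ≤ 15`): for every `C` and `c` there is `n₀`
such that for `n ≥ n₀`, `S ⊆ Y·a`, `TPP(S, gS, g²S)` and `|Y| ≤ C·|S|` force `|S| ≤ √(n!)·e^{-c√n}`. -/
theorem thinnedYoung_card_le_const (C c : ℝ) : ∃ n₀ : ℕ, ∀ n ≥ n₀, ∀ (f : Fin n → ℕ)
    (g a : Equiv.Perm (Fin n)) (S : Finset (Equiv.Perm (Fin n))),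
    (∀ s ∈ S, s * a⁻¹ ∈ youngSubgroup f) →
    TripleProductProperty S (S.image (g * ·)) (S.image (g * g * ·)) →
    (Nat.card (youngSubgroup f) : ℝ) ≤ C * S.card →
    (S.card : ℝ) ≤ Real.sqrt (n.factorial : ℝ) * Real.exp (-(c * Real.sqrt (n : ℝ))) := by
  obtain ⟨n₁, hn₁⟩ := thinnedYoung_card_le c
  refine ⟨n₁ + ⌈(800 * Real.log C) ^ 2⌉₊ + 2, fun n hn f g a S hS hT hC => ?_⟩
  refine hn₁ n (by omega) f g a S hS hT (hC.trans ?_)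
  refine mul_le_mul_of_nonneg_right ?_ (Nat.cast_nonneg _)
  -- `C ≤ exp (n / (400 log n))` because `log C ≤ √n/800 ≤ n/(400 log n)` (`log n ≤ 2√n`)
  have hn2 : (2 : ℝ) ≤ n := by exact_mod_cast (show 2 ≤ n by omega)
  have hnC : (800 * Real.log C) ^ 2 ≤ (n : ℝ) :=
    le_trans (Nat.le_ceil _) (by exact_mod_cast (show ⌈(800 * Real.log C) ^ 2⌉₊ ≤ n by omega))
  have hlogn : 0 < Real.log n := Real.log_pos (by linarith)
  have hsq : 0 < Real.sqrt (n : ℝ) := Real.sqrt_pos.2 (by linarith)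
  have hsqn : Real.sqrt (n : ℝ) * Real.sqrt n = n := Real.mul_self_sqrt (by linarith)
  rcases le_or_gt C 0 with hC0 | hC0
  · exact hC0.trans (Real.exp_pos _).le
  rw [← Real.exp_log hC0, Real.exp_le_exp]
  have h1 : Real.log C ≤ Real.sqrt n / 800 := by
    rcases le_or_gt (Real.log C) 0 with hl | hl
    · linarith
    · have : 800 * Real.log C ≤ Real.sqrt n := by
        calc 800 * Real.log C = Real.sqrt ((800 * Real.log C) ^ 2) := (Real.sqrt_sq (by positivity)).symm
          _ ≤ Real.sqrt n := Real.sqrt_le_sqrt hnC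
      linarith
  have h2 : Real.log n ≤ 2 * Real.sqrt n := by
    have := Real.log_le_sub_one_of_pos hsq
    rw [Real.log_sqrt (by linarith)] at this
    linarith
  have h3 : Real.sqrt (n : ℝ) / 800 ≤ n / (400 * Real.log n) := by
    rw [div_le_div_iff₀ (by norm_num) (by positivity)]
    calc Real.sqrt (n : ℝ) * (400 * Real.log n) ≤ Real.sqrt n * (400 * (2 * Real.sqrt n)) :=
          mul_le_mul_of_nonneg_left (by linarith) hsq.le
      _ = 800 * (Real.sqrt n * Real.sqrt n) := by ring
      _ = n * 800 := by rw [hsqn]; ring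
  exact h1.trans h3

/-- **The thinned-Young design family is empty** (`∀ c` form, sub-exponential thinning): there is no
family of ℤ/3-symmetric TPP witnesses `S ⊆ Y·a` (`Y` Young) above the threshold `√(n!)e^{-c√n}` with
`|Y| ≤ e^{n/(400 log n)}|S|` — already ONE scale `c` fails for all large `n`. -/
theorem not_thinnedYoungSymmetricDesign :
    ¬ (∀ c : ℝ, 0 < c → ∀ n₀ : ℕ, ∃ n ≥ n₀, ∃ f : Fin n → ℕ, ∃ g a : Equiv.Perm (Fin n),
        ∃ S : Finset (Equiv.Perm (Fin n)), (∀ s ∈ S, s * a⁻¹ ∈ youngSubgroup f) ∧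
          TripleProductProperty S (S.image (g * ·)) (S.image (g * g * ·)) ∧
          (Nat.card (youngSubgroup f) : ℝ) ≤ Real.exp (n / (400 * Real.log n)) * S.card ∧
          Real.sqrt (n.factorial : ℝ) * Real.exp (-(c * Real.sqrt (n : ℝ))) < (S.card : ℝ)) := by
  intro h
  obtain ⟨n₀, hn₀⟩ := thinnedYoung_card_le 1
  obtain ⟨n, hn, f, g, a, S, hS, hT, hθ, hbig⟩ := h 1 one_pos n₀
  exact absurd hbig (not_lt.2 (hn₀ n hn f g a S hS hT hθ))

end Summit.MatrixMultiplication.MatrixMultiplication.Theorems.ThresholdSubsetTriples.Negative
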